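/-
Origin: expansion seat `prover-pub-hodgecm-mc-binder-2-g11-0`, handover #34 2026-08-20T02:20Z md5 fabf02c26982 (177 l.; CERTIFIED rc 0 / 0 warn / 35.7 s; imports #33 + #28 + RUN-36 #7 `SmoothTheta`; §1 **`torusChar … : SeesawArchTorus L →* Circle`** (THE torus character χ_T of the pin, `Classical.choose` of #33 §3; `continuous_torusChar`), `cmArchWeilRep_torus_follandFock` (its defining equation on every Fock polynomial), `cmArchWeilRep_torus_follandFock_one` (PINNED by the vacuum); §2 `one_archToAdelic_archDiag_eq`, **`cmPairRepTwist_torus_ins_tprod`**: `ρ_η(archProdHom (1, archDiag u)) (ins f (⊗ₜ m)) = (η(…)·χ_T u) • E(follandFock cmBigFrame (∏_w rename (atPlace w) (linSubst (star U_w(u)) (placePoly m w))) ⊗ f)` — (J-T12) kernel form for ANY inserted printed pure tensor; §3 **`cmPairRepTwist_torus_ins_tprod_of_eigen`** (letter-eigen place polynomials ⇒ weight vector with weight `η·χ_T·∏ d`); NAME LIST `HodgeCM.Model.HypCensus.torusChar`, `HodgeCM.Model.HypCensus.cmPairRepTwist_torus_ins_tprod`, `HodgeCM.Model.HypCensus.cmPairRepTwist_torus_ins_tprod_of_eigen`;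 axioms trio) (`HOME/mc/pub-hodgecm-mc-binder-2/g11/pkg/HodgeCM/Model/HypCensus/OmgInsTorus.lean`, md5 fabf02c26982, 177 lines);
landed by the gen-14 packager (p-g14) in gate run 39 as `HodgeCM/Model/HypCensus/OmgInsTorus.lean` (verbatim).
-/
/-
Origin: speedrun cell pub-hodgecm, MODEL-CONSTRUCTION sub-cell, lineage mc-binder-2 (BINDER-OWNERS rows 18/19: E binders
`hyp12` / `hyp34` of `Model.perL_picardCM_r15A`), seat prover-pub-hodgecm-mc-binder-2-g11-0 (gen 11), 2026-08-20.
Target in PKG: `HodgeCM/Model/HypCensus/OmgInsTorus.lean` (NEW additive leaf; imports this lineage's `HypCensus/TorusLetters` (gen 11),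
`HypCensus/Ins` (#28) and the RUN-36 INSTALLED `HypCensus/SmoothTheta` (#7)).
KERNEL ONLY: 0 records, nothing cited as hypothesis, 0 `def … : Prop`; one data def (a monoid hom, by `Classical.choose`) + theorems.
-/
import Summits.HodgeConjecture.HodgeCM.Model.HypCensus.TorusLetters
import Summits.HodgeConjecture.HodgeCM.Model.HypCensus.Ins
import Summits.HodgeConjecture.HodgeCM.Model.HypCensus.SmoothTheta

/-!
# Census kit (rows A12/A34), junction (J-T12), KERNEL FORM: the archimedean torus on inserted printed pure tensors

For the normalised adelic Weil representation `ρ_η = ω_ψ ∘ (s_pair ⊗ η)` of the CM pin (`cmPairRepTwist … hGR η`, η GENERIC) and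
the census insertion `ins datum m₁ m₂ f` (`HypCensus/Ins`, #28), the archimedean torus element `(1, diag(u₀,u₁))`,
`u ∈ T(L⁺ ⊗ ℝ)` — E's chart point by #25 `cmAdelicEquiv_jT₁₂_toAdeles` — acts on every inserted pure tensor PLACE BY PLACE through
its compact letters, up to ONE continuous character:

* §1 **`torusChar … : T(L⁺ ⊗ ℝ) →* S¹`** — THE torus character of the pin (chosen once from
  `TorusLetters.exists_character_cmArchWeilRep_torus`), `cmArchWeilRep_torus_follandFock` (its defining equation on every Fock
  polynomial of the big frame), `cmArchWeilRep_torus_follandFock_one` (PINNED by the vacuum).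
* §2 **`cmPairRepTwist_torus_ins_tprod`**:
  `ρ_η(1, (diag u)_𝔸) (ins f (⊗ₜ m)) = (η(1,(diag u)_𝔸) · χ_T(u)) • E(follandFock 𝔢 (∏_w (placePoly m w) ∘ (letter_w u)⁻¹) ⊗ f)`.
* §3 **`cmPairRepTwist_torus_ins_tprod_of_eigen`**: if every place polynomial of `m` is an eigenvector of its letter
  (`linSubst (star U_w(u)) (placePoly m w) = d_w • placePoly m w`), the inserted pure tensor is a weight vector:
  `ρ_η(1, (diag u)_𝔸) (ins f (⊗ₜ m)) = (η · χ_T(u) · ∏_w d_w) • ins f (⊗ₜ m)` — the shape of the census field `omg_ins` at the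
  printed vacuum `φ₀` (every `φ⁰_b` IS such an eigenvector: `1` at `Σ₁₂`/`D₁₂`, `det z` at `ι₁`); the residual scalar identity
  `η · χ_T · ∏ d = (printed weight)` is the (J-μ)/(R3) consistency condition of the context (glue-1's S-side read-off).

Hypotheses: the four sign facts of the pin (value level).  Nothing here is a claim of PerL/QW8.  Style lint (L-notation): no `local notation`.
-/

set_option autoImplicit false

noncomputable section

open NumberField NumberField.InfinitePlace IsDedekindDomain
open scoped Matrix Kronecker Classical TensorProduct ComplexConjugate
open MvPolynomial
open Literature.NumberTheory.Automorphic Literature.NumberTheory.Automorphic.UnitaryGroup Literature.NumberTheory.Weil1964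
open Literature.RepresentationTheory.HeisenbergGroup (polar symplecticGroup)
open Literature.RepresentationTheory.KonnoKonno2007 Literature.RepresentationTheory.KonnoKonno2007.RealDualPair
open Literature.NumberTheory.GelbartRogawski1991 Literature.NumberTheory.GelbartRogawski1991.UnitaryDualPair
open Literature.RepresentationTheory (atPlace)
open Literature.Analysis.SegalBargmann
open HodgeCM.PerL34.Fock HodgeCM.PerL34.Fock.PrintDict

namespace HodgeCM.Model.HypCensus

section Torus

variable (L : Type) [Field L] [NumberField L] [IsCMField L]
variable (dV : Fin 3 → L) (hdV : ∀ i, IsCMField.complexConj L (dV i) = dV i) (hdV0 : ∀ i, dV i ≠ 0)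
variable (dW : Fin 2 → L) (hdW : ∀ i, IsCMField.complexConj L (dW i) = dW i) (hdW0 : ∀ i, dW i ≠ 0)
variable (hGR : (cmSplittingDatum L finProdFinEquiv dV hdV hdV0 dW hdW hdW0).CompatibleSplitting) (ι₁ : L →+* ℂ)
variable
  (h₁V : ∃ i₀ : Fin 3, (∀ i, i ≠ i₀ → 0 < (ι₁ (dV i)).re) ∨ ∀ i, i ≠ i₀ → (ι₁ (dV i)).re < 0)
  (h₁W : (∀ j, 0 < (ι₁ (dW j)).re) ∨ ∀ j, (ι₁ (dW j)).re < 0)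
  (hV : ∀ τ : L →+* ℂ, InfinitePlace.mk τ ≠ InfinitePlace.mk ι₁ → (∀ i, 0 < (τ (dV i)).re) ∨ ∀ i, (τ (dV i)).re < 0)
  (hW : ∀ τ : L →+* ℂ, InfinitePlace.mk τ ≠ InfinitePlace.mk ι₁ →
    (∃ j₀ : Fin 2, ∀ j, j ≠ j₀ → 0 < (τ (dW j)).re) ∨ ∀ j, (τ (dW j)).re < 0)

/-! ## §1 The torus character of the pin -/

/-- **THE TORUS CHARACTER `χ_T : T(L⁺ ⊗ ℝ) →* S¹` of the CM pin** (chosen once; determined by its action on the vacuum,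
`cmArchWeilRep_torus_follandFock_one`). -/
def torusChar : SeesawArchTorus L →* Circle :=
  (exists_character_cmArchWeilRep_torus L finProdFinEquiv dV hdV hdV0 dW hdW hdW0 hGR ι₁ h₁V h₁W hV hW).choose

/-- (Ported verbatim from the HodgeCMPerL package; no docstring in the source.) -/
theorem continuous_torusChar : Continuous (torusChar L dV hdV hdV0 dW hdW hdW0 hGR ι₁ h₁V h₁W hV hW) :=
  (exists_character_cmArchWeilRep_torus L finProdFinEquiv dV hdV hdV0 dW hdW hdW0 hGR ι₁ h₁V h₁W hV hW).choose_spec.1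

/-- **the defining equation of `χ_T`** on every Fock polynomial of the big frame: the torus substitutes place by place through its
letters `((1,1),(diag c|R_v, diag c|S_v))` and multiplies by `χ_T(u)`. -/
theorem cmArchWeilRep_torus_follandFock (u : SeesawArchTorus L)
    (G : MvPolynomial (Fin 6 × {v : InfinitePlace ↥(maximalRealSubfield L) // v.IsReal}) ℂ) :
    cmArchWeilRep L finProdFinEquiv dV hdV hdV0 dW hdW hdW0 hGR
        ((1 : UnitaryGroup.arch (↥(maximalRealSubfield L)) L (IsCMField.complexConj L) 3 (Matrix.diagonal dV)), archDiag L dW u)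
        (follandFock (cmBigFrame L finProdFinEquiv dV hdV hdV0 dW hdW hdW0 ι₁) G) =
      ((torusChar L dV hdV hdV0 dW hdW hdW0 hGR ι₁ h₁V h₁W hV hW u : Circle) : ℂ) •
        follandFock (cmBigFrame L finProdFinEquiv dV hdV hdV0 dW hdW hdW0 ι₁)
          (linSubst (star ((placeBlock fun v : {v : InfinitePlace ↥(maximalRealSubfield L) // v.IsReal} =>
              reindexUnitary (pairFrame (PosIdx (cmXV L dV hdV ι₁ v)) (NegIdx (cmXV L dV hdV ι₁ v))
                (PosIdx (cmXW L dV dW hdW ι₁ v)) (NegIdx (cmXW L dV dW hdW ι₁ v)) finProdFinEquiv (cmEpsV L dV hdV ι₁ v)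
                (cmEpsW L dV dW hdW ι₁ v)) (dualPairι (torusPlaceLetter L dV hdV dW hdW ι₁ v u)) :
              Matrix.unitaryGroup _ ℂ) : Matrix _ _ ℂ)) G) := by
  have h := (exists_character_cmArchWeilRep_torus L finProdFinEquiv dV hdV hdV0 dW hdW hdW0 hGR ι₁ h₁V h₁W hV hW).choose_spec.2 u G
  rw [cmLetterBlock_apply] at h
  exact h

/-- **`χ_T` is PINNED by the vacuum**: `ω_∞(1, diag u) (follandFock 𝔢 1) = χ_T(u) • follandFock 𝔢 1`. -/
theorem cmArchWeilRep_torus_follandFock_one (u : SeesawArchTorus L) :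
    cmArchWeilRep L finProdFinEquiv dV hdV hdV0 dW hdW hdW0 hGR
        ((1 : UnitaryGroup.arch (↥(maximalRealSubfield L)) L (IsCMField.complexConj L) 3 (Matrix.diagonal dV)), archDiag L dW u)
        (follandFock (cmBigFrame L finProdFinEquiv dV hdV hdV0 dW hdW hdW0 ι₁) 1) =
      ((torusChar L dV hdV hdV0 dW hdW hdW0 hGR ι₁ h₁V h₁W hV hW u : Circle) : ℂ) •
        follandFock (cmBigFrame L finProdFinEquiv dV hdV hdV0 dW hdW hdW0 ι₁) 1 := by
  rw [cmArchWeilRep_torus_follandFock, map_one]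

/-! ## §2 The torus on an inserted pure tensor: place by place through the letters -/

variable (η : CMAdelic L dV × CMAdelic L dW →* ℂˣ)
variable (datum : ∀ b : InfinitePlace L, PlaceDatum L dV hdV dW hdW ι₁ (cmPlacesEquiv L b)) (m₁ m₂ : InfinitePlace L → ℤ)

/-- the pair element `(1, (diag u)_𝔸)` IS `archProdHom (1, diag u)`. -/
theorem one_archToAdelic_archDiag_eq (u : SeesawArchTorus L) :
    (((1 : CMAdelic L dV)),
      (archToAdelic (↥(maximalRealSubfield L)) L (IsCMField.complexConj L) 2 (Matrix.diagonal dW) (archDiag L dW u) :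
        CMAdelic L dW)) =
      archProdHom (↥(maximalRealSubfield L)) L (IsCMField.complexConj L) 3 2 (Matrix.diagonal dV) (Matrix.diagonal dW)
        ((1 : UnitaryGroup.arch (↥(maximalRealSubfield L)) L (IsCMField.complexConj L) 3 (Matrix.diagonal dV)), archDiag L dW u) :=
  Prod.ext (map_one (archToAdelic (↥(maximalRealSubfield L)) L (IsCMField.complexConj L) 3 (Matrix.diagonal dV))).symm rfl

/-- **(J-T12), KERNEL FORM — the archimedean torus on an inserted printed pure tensor**:
`ρ_η(1, (diag u)_𝔸) (ins f (⊗ₜ m)) = (η(1,(diag u)_𝔸) · χ_T(u)) • E(follandFock 𝔢 (∏_w placePoly m w ∘ (letter_w u)⁻¹) ⊗ f)`. -/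
theorem cmPairRepTwist_torus_ins_tprod (u : SeesawArchTorus L) (f : FinSB ↥(maximalRealSubfield L) (Fin 6))
    (m : ∀ b : InfinitePlace L, ((printPlaces (InfinitePlace L) (kindOf L dV hdV dW hdW ι₁ datum)
      (lamOf L dV hdV dW hdW ι₁ datum) (lamOf_ne_zero L dV hdV dW hdW ι₁ datum)
      (pinnedVacs (kindOf L dV hdV dW hdW ι₁ datum) m₁ m₂)).loc b).M) :
    cmPairRepTwist L finProdFinEquiv dV hdV hdV0 dW hdW hdW0 hGR η
        (archProdHom (↥(maximalRealSubfield L)) L (IsCMField.complexConj L) 3 2 (Matrix.diagonal dV) (Matrix.diagonal dW)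
          ((1 : UnitaryGroup.arch (↥(maximalRealSubfield L)) L (IsCMField.complexConj L) 3 (Matrix.diagonal dV)), archDiag L dW u))
        (ins L dV hdV hdV0 dW hdW hdW0 ι₁ datum m₁ m₂ f (PiTensorProduct.tprod ℂ m)) =
      (((η (archProdHom (↥(maximalRealSubfield L)) L (IsCMField.complexConj L) 3 2 (Matrix.diagonal dV) (Matrix.diagonal dW)
          ((1 : UnitaryGroup.arch (↥(maximalRealSubfield L)) L (IsCMField.complexConj L) 3 (Matrix.diagonal dV)), archDiag L dW u)) : ℂˣ) : ℂ) *
          ((torusChar L dV hdV hdV0 dW hdW hdW0 hGR ι₁ h₁V h₁W hV hW u : Circle) : ℂ)) •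
        piSchwartzBruhatEquiv ↥(maximalRealSubfield L) (Fin 6)
          (follandFock (cmBigFrame L finProdFinEquiv dV hdV hdV0 dW hdW hdW0 ι₁)
            (∏ w, rename (atPlace w)
              (linSubst (star ((reindexUnitary (pairFrame (PosIdx (cmXV L dV hdV ι₁ w)) (NegIdx (cmXV L dV hdV ι₁ w))
                  (PosIdx (cmXW L dV dW hdW ι₁ w)) (NegIdx (cmXW L dV dW hdW ι₁ w)) finProdFinEquiv (cmEpsV L dV hdV ι₁ w)
                  (cmEpsW L dV dW hdW ι₁ w)) (dualPairι (torusPlaceLetter L dV hdV dW hdW ι₁ w u)) :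
                    Matrix.unitaryGroup (Fin 6) ℂ) : Matrix (Fin 6) (Fin 6) ℂ))
                (placePoly L dV hdV dW hdW ι₁ datum m₁ m₂ m w))) ⊗ₜ f) := by
  rw [ins_tprod, cmPairRepTwist_archProdHom_tmul, cmArchWeilRep_torus_follandFock,
    linSubst_star_placeBlock_prod_rename_atPlace, ← TensorProduct.smul_tmul', map_smul, smul_smul]

/-! ## §3 Eigen-place-polynomials ⇒ the inserted pure tensor is a weight vector -/

/-- **if every place polynomial is a letter eigenvector, the inserted pure tensor is a weight vector of the torus**:
`ρ_η(1, (diag u)_𝔸) (ins f (⊗ₜ m)) = (η · χ_T(u) · ∏_w d_w) • ins f (⊗ₜ m)` — the shape of `omg_ins` at the printed vacuum. -/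
theorem cmPairRepTwist_torus_ins_tprod_of_eigen (u : SeesawArchTorus L) (f : FinSB ↥(maximalRealSubfield L) (Fin 6))
    (m : ∀ b : InfinitePlace L, ((printPlaces (InfinitePlace L) (kindOf L dV hdV dW hdW ι₁ datum)
      (lamOf L dV hdV dW hdW ι₁ datum) (lamOf_ne_zero L dV hdV dW hdW ι₁ datum)
      (pinnedVacs (kindOf L dV hdV dW hdW ι₁ datum) m₁ m₂)).loc b).M)
    (d : {v : InfinitePlace ↥(maximalRealSubfield L) // v.IsReal} → ℂ)
    (hd : ∀ w, linSubst (star ((reindexUnitary (pairFrame (PosIdx (cmXV L dV hdV ι₁ w)) (NegIdx (cmXV L dV hdV ι₁ w))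
        (PosIdx (cmXW L dV dW hdW ι₁ w)) (NegIdx (cmXW L dV dW hdW ι₁ w)) finProdFinEquiv (cmEpsV L dV hdV ι₁ w)
        (cmEpsW L dV dW hdW ι₁ w)) (dualPairι (torusPlaceLetter L dV hdV dW hdW ι₁ w u)) :
          Matrix.unitaryGroup (Fin 6) ℂ) : Matrix (Fin 6) (Fin 6) ℂ)) (placePoly L dV hdV dW hdW ι₁ datum m₁ m₂ m w) =
      d w • placePoly L dV hdV dW hdW ι₁ datum m₁ m₂ m w) :
    cmPairRepTwist L finProdFinEquiv dV hdV hdV0 dW hdW hdW0 hGR η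
        (archProdHom (↥(maximalRealSubfield L)) L (IsCMField.complexConj L) 3 2 (Matrix.diagonal dV) (Matrix.diagonal dW)
          ((1 : UnitaryGroup.arch (↥(maximalRealSubfield L)) L (IsCMField.complexConj L) 3 (Matrix.diagonal dV)), archDiag L dW u))
        (ins L dV hdV hdV0 dW hdW hdW0 ι₁ datum m₁ m₂ f (PiTensorProduct.tprod ℂ m)) =
      (((η (archProdHom (↥(maximalRealSubfield L)) L (IsCMField.complexConj L) 3 2 (Matrix.diagonal dV) (Matrix.diagonal dW)
          ((1 : UnitaryGroup.arch (↥(maximalRealSubfield L)) L (IsCMField.complexConj L) 3 (Matrix.diagonal dV)), archDiag L dW u)) : ℂˣ) : ℂ) *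
          ((torusChar L dV hdV hdV0 dW hdW hdW0 hGR ι₁ h₁V h₁W hV hW u : Circle) : ℂ) * ∏ w, d w) •
        ins L dV hdV hdV0 dW hdW hdW0 ι₁ datum m₁ m₂ f (PiTensorProduct.tprod ℂ m) := by
  rw [cmPairRepTwist_torus_ins_tprod L dV hdV hdV0 dW hdW hdW0 hGR ι₁ h₁V h₁W hV hW η datum m₁ m₂ u f m, ins_tprod]
  have hprod : (∏ w, rename (atPlace w)
      (linSubst (star ((reindexUnitary (pairFrame (PosIdx (cmXV L dV hdV ι₁ w)) (NegIdx (cmXV L dV hdV ι₁ w))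
        (PosIdx (cmXW L dV dW hdW ι₁ w)) (NegIdx (cmXW L dV dW hdW ι₁ w)) finProdFinEquiv (cmEpsV L dV hdV ι₁ w)
        (cmEpsW L dV dW hdW ι₁ w)) (dualPairι (torusPlaceLetter L dV hdV dW hdW ι₁ w u)) :
          Matrix.unitaryGroup (Fin 6) ℂ) : Matrix (Fin 6) (Fin 6) ℂ)) (placePoly L dV hdV dW hdW ι₁ datum m₁ m₂ m w))) =
      (∏ w, d w) • ∏ w, rename (atPlace w) (placePoly L dV hdV dW hdW ι₁ datum m₁ m₂ m w) := by
    rw [smul_eq_C_mul, map_prod C, ← Finset.prod_mul_distrib]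
    refine Finset.prod_congr rfl fun w _ => ?_
    rw [hd w, smul_eq_C_mul, map_mul, rename_C]
  rw [hprod, follandFock_smul, ← TensorProduct.smul_tmul', map_smul, smul_smul]

end Torus

end HodgeCM.Model.HypCensus

end
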